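import Literature.Probability.LatticeModels.DiscreteExtremalLengthExternalArcs
import HarnessLib

/-!
# Inner versus external arcs of a discrete topological rectangle: proof of the sandwich
# `ℓ_Ω ≤ ℓ_Ω̄ ≤ ℓ_Ω + 4(2√2 - 1)` (Chelkak–Duminil-Copin–Hongler 2016, §3.3)

Sibling proof file of `Literature.Probability.LatticeModels.DiscreteExtremalLengthExternalArcs`, which
types the completed graph `Ω̄ = Ω ∪ ∂_ext Ω` (`DiscreteRect.extGraph`: one formal external vertex
`inr d` of degree one per external dart `d = (x, k)`, joined to `inl x`), the external arcs
`DiscreteRect.extArc` and the resistance `DiscreteRect.extResistance` between them, and vendors the first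
displayed property of D. Chelkak, H. Duminil-Copin, C. Hongler, *Crossing probabilities in topological
rectangles for the critical planar FK-Ising model*, Electron. J. Probab. 21 (2016), no. 5, §3.3,

  `ℓ_Ω[(ab),(cd)] ≤ ℓ_Ω̄[(a_ext b_ext),(c_ext d_ext)] ≤ ℓ_Ω[(ab),(cd)] + 4(2√2 - 1)`,

as the named fact `discreteEL_ext_sandwich`. The paper prints this line without proof; it is
**discharged here** (`discreteEL_ext_sandwich_holds`) by an elementary Dirichlet-principle argument on
the tree's definition `effectiveResistance = (inf admissible energies)⁻¹` (`EffectiveResistance.lean`):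

* `DiscreteRect.innerResistance_le_extResistance` (`ℓ_Ω ≤ ℓ_Ω̄`, i.e. `𝒞̄ ≤ 𝒞`): a potential `v` of
  `Ω` with `v ≡ 1` on `(ab)`, `v ≡ 0` on `(cd)` extends to `Ω̄` by `v(x_ext) := v(x)` along the pendant
  edges; the extension is admissible for the external arcs (an external vertex of the arc
  `(a_ext b_ext)` hangs at a vertex of `(ab)`) and has the same energy
  (`DiscreteRect.networkEnergy_sumElim_le`).
* `DiscreteRect.extResistance_le_innerResistance_add_two` (`ℓ_Ω̄ ≤ ℓ_Ω + 2`, sharper than the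
  printed constant `4(2√2 - 1) ≈ 7.31 ≥ 2`, and optimal: equality for one-dart arcs by the series law):
  for a potential `u` of `Ω̄`, `u ≡ 1` on `(a_ext b_ext)`, `u ≡ 0` on `(c_ext d_ext)`, let `α` be the
  minimum of `u` on `(ab)` (attained at `x_a`, carrying a dart of the arc) and `β` its maximum on `(cd)`
  (at `x_c`). Keeping only the two pendant edges at `x_a, x_c` and the inner edges
  (`DiscreteRect.add_networkEnergy_comp_inl_le`),
  `E_Ω̄(u) ≥ (1-α)² + β² + E_Ω(u|_Ω)`, and `E_Ω(u|_Ω) ≥ 𝒞 (α-β)²` when `β < α` because the clamped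
  rescaling `max 0 (min 1 ((u-β)/(α-β)))` is admissible for `((ab),(cd))` and clamping is a
  contraction (`DiscreteRect.effectiveConductance_mul_le_networkEnergy`); finally Cauchy–Schwarz for
  `1 = (1-α) + (α-β) + β` gives `(1-α)² + 𝒞(α-β)² + β² ≥ (2 + 𝒞⁻¹)⁻¹` (and `≥ 1/2` if `α ≤ β`)
  (`DiscreteRect.inv_inv_add_two_le`), i.e. `𝒞̄ ≥ (𝒞⁻¹ + 2)⁻¹`.
* the lattice input `DiscreteRect.IsExtDart.succ`: boundary tracing `DiscreteRect.succ` maps external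
  darts to external darts (so every dart of the boundary cycle of `IsRect E d₀ n` carries a pendant
  edge of `Ω̄`).

All energies are `ℝ≥0∞`-valued `tsum`s over `Sym2`; the comparisons go through the injection
`Sym2.map Sum.inl` (`Function.Injective.tsum_eq`, `ENNReal.tsum_comp_le_tsum_of_injective`), so no
finiteness bookkeeping is needed. Nothing here is specific to `q = 2`.

## References
* [ChelkakDuminilCopinHongler2016] D. Chelkak, H. Duminil-Copin, C. Hongler, EJP 21 (2016) no. 5
  (arXiv:1312.7785), §3.3, first displayed property (stated without proof).
* [LyonsPeres2016] R. Lyons, Y. Peres, *Probability on Trees and Networks*, CUP 2016, §2.4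
  (Dirichlet's principle, Exercise 2.13), the definition used by `EffectiveResistance.lean`.
-/

noncomputable section

open scoped ENNReal NNReal
open SimpleGraph

namespace Literature.Probability.LatticeModels

namespace DiscreteRect

/-! ### Abstract network lemmas: a graph `G` on `V` inside a graph `G'` on `V ⊕ D` with pendant edges -/

section Abstract

variable {V D : Type*}

/-- The summand of the unit-conductance energy. [folklore] -/
theorem networkEnergy_one_eq (G : SimpleGraph V) (v : V → ℝ) :
    networkEnergy G 1 v = ∑' e, G.edgeSet.indicator (fun e ↦ ENNReal.ofReal (sqIncr v e)) e := by
  simp [networkEnergy]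

/-- **Extending a potential along pendant edges does not increase the energy**: if the
`inl`–`inl` edges of `G'` are edges of `G`, every `inl x`–`inr d` edge of `G'` has `base d = x`, and
`G'` has no `inr`–`inr` edges, then `Sum.elim v (v ∘ base)` has `G'`-energy at most the `G`-energy
of `v` (the pendant increments vanish). [folklore] -/
theorem networkEnergy_sumElim_le (G : SimpleGraph V) (G' : SimpleGraph (V ⊕ D)) (base : D → V)
    (hll : ∀ x y, G'.Adj (.inl x) (.inl y) → G.Adj x y)
    (hlr : ∀ x d, G'.Adj (.inl x) (.inr d) → base d = x)
    (hrr : ∀ d d', ¬ G'.Adj (.inr d) (.inr d'))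
    (v : V → ℝ) :
    networkEnergy G' 1 (Sum.elim v (v ∘ base)) ≤ networkEnergy G 1 v := by
  set u : V ⊕ D → ℝ := Sum.elim v (v ∘ base) with hu
  rw [networkEnergy_one_eq, networkEnergy_one_eq]
  set F : Sym2 (V ⊕ D) → ℝ≥0∞ := G'.edgeSet.indicator (fun e ↦ ENNReal.ofReal (sqIncr u e)) with hF
  have hsupp : Function.support F ⊆ Set.range (Sym2.map Sum.inl) := by
    intro e
    induction e using Sym2.ind with
    | h p q =>
      intro hpq
      rw [Function.mem_support, hF] at hpq
      obtain p | p := p <;> obtain q | q := q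
      · exact ⟨s(p, q), rfl⟩
      · exfalso
        refine hpq (Set.indicator_apply_eq_zero.2 fun hadj ↦ ?_)
        have := hlr p q ((mem_edgeSet G').1 hadj)
        simp [u, this]
      · exfalso
        refine hpq (Set.indicator_apply_eq_zero.2 fun hadj ↦ ?_)
        have := hlr q p ((mem_edgeSet G').1 hadj).symm
        simp [u, this]
      · have : s(Sum.inr p, Sum.inr q) ∉ G'.edgeSet := (mem_edgeSet G').not.2 (hrr p q)
        exact absurd (Set.indicator_of_notMem this _) hpq
  rw [← (Sym2.map.injective Sum.inl_injective).tsum_eq hsupp]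
  refine ENNReal.tsum_le_tsum fun e ↦ ?_
  induction e using Sym2.ind with
  | h x y =>
    by_cases hadj : G'.Adj (.inl x) (.inl y)
    · have hG : s(x, y) ∈ G.edgeSet := (mem_edgeSet G).2 (hll x y hadj)
      have hG' : s(Sum.inl x, Sum.inl y) ∈ G'.edgeSet := (mem_edgeSet G').2 hadj
      rw [Sym2.map_mk, hF, Set.indicator_of_mem hG', Set.indicator_of_mem hG]
      simp [u]
    · have hG' : s(Sum.inl x, Sum.inl y) ∉ G'.edgeSet := (mem_edgeSet G').not.2 hadj
      rw [Sym2.map_mk, hF, Set.indicator_of_notMem hG']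
      exact zero_le

/-- **Two distinct pendant edges and the inner edges are disjoint parts of the energy**: if the edges
of `G` are `inl`–`inl` edges of `G'`, then for every potential `u` of `G'` and pendant edges
`inl a – inr da ≠ inl z – inr dz` of `G'`,
`(u(inl a) - u(inr da))² + (u(inl z) - u(inr dz))² + E_G(u ∘ inl) ≤ E_{G'}(u)`. [folklore] -/
theorem add_networkEnergy_comp_inl_le (G : SimpleGraph V) (G' : SimpleGraph (V ⊕ D))
    (hll : ∀ x y, G.Adj x y → G'.Adj (.inl x) (.inl y))
    (u : V ⊕ D → ℝ) {a z : V} {da dz : D}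
    (ha : G'.Adj (.inl a) (.inr da)) (hz : G'.Adj (.inl z) (.inr dz)) (hne : da ≠ dz) :
    ENNReal.ofReal ((u (.inl a) - u (.inr da)) ^ 2) + ENNReal.ofReal ((u (.inl z) - u (.inr dz)) ^ 2)
      + networkEnergy G 1 (u ∘ Sum.inl) ≤ networkEnergy G' 1 u := by
  rw [networkEnergy_one_eq, networkEnergy_one_eq]
  set F : Sym2 (V ⊕ D) → ℝ≥0∞ := G'.edgeSet.indicator (fun e ↦ ENNReal.ofReal (sqIncr u e)) with hF
  set g : Sym2 V ⊕ Bool → Sym2 (V ⊕ D) :=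
    Sum.elim (Sym2.map Sum.inl) (fun b ↦ bif b then s(.inl z, .inr dz) else s(.inl a, .inr da)) with hg
  have hnot : ∀ (e : Sym2 V) (x : V) (d : D), Sym2.map Sum.inl e ≠ s(.inl x, .inr d) := by
    intro e x d h
    have hmem : (Sum.inr d : V ⊕ D) ∈ Sym2.map Sum.inl e := by rw [h]; exact Sym2.mem_mk_right _ _
    obtain ⟨w, -, hw⟩ := Sym2.mem_map.1 hmem
    exact Sum.inl_ne_inr hw
  have hginj : Function.Injective g := by
    rintro (e | b) (e' | b') h
    · exact congrArg Sum.inl (Sym2.map.injective Sum.inl_injective h)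
    · cases b'
      · exact absurd h (hnot e a da)
      · exact absurd h (hnot e z dz)
    · cases b
      · exact absurd h.symm (hnot e' a da)
      · exact absurd h.symm (hnot e' z dz)
    · cases b <;> cases b'
      · rfl
      · exfalso
        have h' : s(Sum.inl a, Sum.inr da) = s((Sum.inl z : V ⊕ D), Sum.inr dz) := h
        rcases Sym2.eq_iff.1 h' with ⟨-, h2⟩ | ⟨h2, -⟩
        · exact hne (Sum.inr_injective h2)
        · exact Sum.inl_ne_inr h2
      · exfalso
        have h' : s((Sum.inl z : V ⊕ D), Sum.inr dz) = s(Sum.inl a, Sum.inr da) := h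
        rcases Sym2.eq_iff.1 h' with ⟨-, h2⟩ | ⟨h2, -⟩
        · exact hne (Sum.inr_injective h2).symm
        · exact Sum.inl_ne_inr h2
      · rfl
  have hFa : F s(.inl a, .inr da) = ENNReal.ofReal ((u (.inl a) - u (.inr da)) ^ 2) := by
    rw [hF, Set.indicator_of_mem ((mem_edgeSet G').2 ha), sqIncr_mk]
  have hFz : F s(.inl z, .inr dz) = ENNReal.ofReal ((u (.inl z) - u (.inr dz)) ^ 2) := by
    rw [hF, Set.indicator_of_mem ((mem_edgeSet G').2 hz), sqIncr_mk]
  calc ENNReal.ofReal ((u (.inl a) - u (.inr da)) ^ 2) + ENNReal.ofReal ((u (.inl z) - u (.inr dz)) ^ 2)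
        + ∑' e, G.edgeSet.indicator (fun e ↦ ENNReal.ofReal (sqIncr (u ∘ Sum.inl) e)) e
      ≤ (∑' b : Bool, F (g (.inr b))) + ∑' e, F (g (.inl e)) := by
        rw [tsum_bool]
        refine add_le_add (le_of_eq ?_) (ENNReal.tsum_le_tsum fun e ↦ ?_)
        · simp only [g, Sum.elim_inr, cond_false, cond_true]
          rw [hFa, hFz]
        induction e using Sym2.ind with
        | h x y =>
          by_cases hadj : G.Adj x y
          · have hG : s(x, y) ∈ G.edgeSet := (mem_edgeSet G).2 hadj
            have hG' : s(Sum.inl x, Sum.inl y) ∈ G'.edgeSet := (mem_edgeSet G').2 (hll x y hadj)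
            simp only [g, Sum.elim_inl, Sym2.map_mk, hF]
            rw [Set.indicator_of_mem hG', Set.indicator_of_mem hG]
            simp
          · have hG : s(x, y) ∉ G.edgeSet := (mem_edgeSet G).not.2 hadj
            rw [Set.indicator_of_notMem hG]
            exact zero_le
    _ = ∑' i, F (g i) := by
        rw [add_comm]
        exact (Summable.tsum_sum (f := F ∘ g) ENNReal.summable ENNReal.summable).symm
    _ ≤ ∑' e, F e := ENNReal.tsum_comp_le_tsum_of_injective hginj F

/-- **Clamping**: if `u ≥ α` on `A`, `u ≤ β` on `Z` and `β < α`, then the clamped rescaling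
`max 0 (min 1 ((u - β)/(α - β)))` is admissible for `(A, Z)` and, clamping being a contraction, has
energy `≤ E(u)/(α-β)²`; whence `𝒞(A ↔ Z) · (α - β)² ≤ E(u)` by Dirichlet's principle. [folklore] -/
theorem effectiveConductance_mul_le_networkEnergy (G : SimpleGraph V) (c : Sym2 V → ℝ≥0)
    {A Z : Set V} (u : V → ℝ) {α β : ℝ} (hβα : β < α)
    (hA : ∀ x ∈ A, α ≤ u x) (hZ : ∀ x ∈ Z, u x ≤ β) :
    effectiveConductance G c A Z * ENNReal.ofReal ((α - β) ^ 2) ≤ networkEnergy G c u := by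
  have hd : 0 < α - β := sub_pos.2 hβα
  -- the clamp `t ↦ max 0 (min 1 t)` is `1`-Lipschitz
  have hclamp : ∀ s t : ℝ, |max 0 (min 1 s) - max 0 (min 1 t)| ≤ |s - t| := fun s t ↦
    calc |max 0 (min 1 s) - max 0 (min 1 t)| ≤ max |(0 : ℝ) - 0| |min 1 s - min 1 t| :=
          abs_max_sub_max_le_max _ _ _ _
      _ = |min 1 s - min 1 t| := by simp
      _ ≤ max |(1 : ℝ) - 1| |s - t| := abs_min_sub_min_le_max _ _ _ _
      _ = |s - t| := by simp
  set w : V → ℝ := fun x ↦ max 0 (min 1 ((u x - β) / (α - β))) with hw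
  have hwA : A.EqOn w 1 := fun x hx ↦ by
    have h1 : 1 ≤ (u x - β) / (α - β) := by
      rw [le_div_iff₀ hd]; linarith [hA x hx]
    simp [w, min_eq_left h1]
  have hwZ : Z.EqOn w 0 := fun x hx ↦ by
    have h0 : (u x - β) / (α - β) ≤ 0 :=
      div_nonpos_of_nonpos_of_nonneg (by linarith [hZ x hx]) hd.le
    simpa [w] using (min_le_right _ _).trans h0
  have hlip : ∀ x y, (w x - w y) ^ 2 * (α - β) ^ 2 ≤ (u x - u y) ^ 2 := by
    intro x y
    have h1 : |w x - w y| ≤ |(u x - u y) / (α - β)| := by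
      refine (hclamp _ _).trans (le_of_eq ?_)
      rw [← sub_div]
      congr 2
      ring
    have h2 : (w x - w y) ^ 2 ≤ ((u x - u y) / (α - β)) ^ 2 := sq_le_sq.2 h1
    rw [div_pow, le_div_iff₀ (pow_pos hd 2)] at h2
    exact h2
  calc effectiveConductance G c A Z * ENNReal.ofReal ((α - β) ^ 2)
      ≤ networkEnergy G c w * ENNReal.ofReal ((α - β) ^ 2) :=
        mul_le_mul' (effectiveConductance_le_networkEnergy hwA hwZ) le_rfl
    _ = ∑' e, G.edgeSet.indicator (fun e ↦ (c e : ℝ≥0∞) * ENNReal.ofReal (sqIncr w e)) e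
          * ENNReal.ofReal ((α - β) ^ 2) := by
        rw [networkEnergy, ENNReal.tsum_mul_right]
    _ ≤ networkEnergy G c u := ENNReal.tsum_le_tsum fun e ↦ ?_
  by_cases he : e ∈ G.edgeSet
  · rw [Set.indicator_of_mem he, Set.indicator_of_mem he, mul_assoc,
      ← ENNReal.ofReal_mul (sqIncr_nonneg _ _)]
    gcongr
    induction e using Sym2.ind with
    | h x y => simpa only [sqIncr_mk] using hlip x y
  · simp [Set.indicator_of_notMem he]

/-- **The scalar inequality** behind `ℓ_Ω̄ ≤ ℓ_Ω + 2`: for `C, P ∈ [0, ∞]` and reals `α, β` with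
`C (α - β)² ≤ P` whenever `β < α`, one has `(C⁻¹ + 2)⁻¹ ≤ (1 - α)² + β² + P` (Cauchy–Schwarz for
`1 = (1 - α) + (α - β) + β` against the weights `1, C, 1`; if `α ≤ β` the first two terms are already
`≥ 1/2`). [folklore] -/
theorem inv_inv_add_two_le (C P : ℝ≥0∞) (α β : ℝ)
    (hP : β < α → C * ENNReal.ofReal ((α - β) ^ 2) ≤ P) :
    (C⁻¹ + 2)⁻¹ ≤ ENNReal.ofReal ((1 - α) ^ 2) + ENNReal.ofReal (β ^ 2) + P := by
  have h2 : (C⁻¹ + 2)⁻¹ ≤ ENNReal.ofReal (1 / 2) := by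
    rw [one_div, ENNReal.ofReal_inv_of_pos two_pos, ENNReal.ofReal_ofNat]
    exact ENNReal.inv_le_inv' le_add_self
  rcases le_or_gt α β with hαβ | hβα
  · -- no current can flow: the two pendant terms already cost `≥ 1/2`
    refine h2.trans (le_add_right ?_)
    rw [← ENNReal.ofReal_add (sq_nonneg _) (sq_nonneg _)]
    refine ENNReal.ofReal_le_ofReal ?_
    rcases le_or_gt 0 α with h0 | h0
    · nlinarith [sq_nonneg (α - 1 / 2), mul_self_le_mul_self h0 hαβ]
    · nlinarith
  · have hP' := hP hβα
    have hd : 0 < (α - β) ^ 2 := pow_pos (sub_pos.2 hβα) 2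
    rcases eq_or_ne C ⊤ with rfl | hCtop
    · have hne : ENNReal.ofReal ((α - β) ^ 2) ≠ 0 := (ENNReal.ofReal_pos.2 hd).ne'
      rw [ENNReal.top_mul hne, top_le_iff] at hP'
      simp [hP']
    rcases eq_or_ne C 0 with rfl | hC0
    · simp
    have hc : 0 < C.toReal := ENNReal.toReal_pos hC0 hCtop
    set c := C.toReal with hcdef
    have hC : C = ENNReal.ofReal c := (ENNReal.ofReal_toReal hCtop).symm
    calc (C⁻¹ + 2)⁻¹ = ENNReal.ofReal ((c⁻¹ + 2)⁻¹) := by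
          have h2 : (2 : ℝ≥0∞) = ENNReal.ofReal 2 := (ENNReal.ofReal_ofNat 2).symm
          rw [hC, ← ENNReal.ofReal_inv_of_pos hc, h2,
            ← ENNReal.ofReal_add (inv_pos.2 hc).le (by norm_num),
            ← ENNReal.ofReal_inv_of_pos (by positivity)]
      _ ≤ ENNReal.ofReal ((1 - α) ^ 2 + β ^ 2 + c * (α - β) ^ 2) := by
          refine ENNReal.ofReal_le_ofReal ?_
          have hval : (c⁻¹ + 2)⁻¹ = c / (1 + 2 * c) := by field_simp
          rw [hval, div_le_iff₀ (by positivity)]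
          -- Lagrange's identity: `(1+2c)(x² + c y² + w²) - c (x+y+w)² = (x-cy)² + c(x-w)² + (cy-w)²`
          nlinarith [sq_nonneg ((1 - α) - c * (α - β)), sq_nonneg (c * (α - β) - β),
            mul_nonneg hc.le (sq_nonneg ((1 - α) - β))]
      _ = ENNReal.ofReal ((1 - α) ^ 2) + ENNReal.ofReal (β ^ 2)
            + C * ENNReal.ofReal ((α - β) ^ 2) := by
          rw [hC, ← ENNReal.ofReal_mul hc.le, ← ENNReal.ofReal_add (sq_nonneg _) (sq_nonneg _),
            ← ENNReal.ofReal_add (add_nonneg (sq_nonneg _) (sq_nonneg _)) (by positivity)]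
      _ ≤ _ := by gcongr

end Abstract

/-! ### The completed graph `Ω̄` of a discrete domain of `ℤ²` -/

section Lattice

variable {E : Finset (Sym2 (Site 2))}

/-- Adjacency of two lattice vertices in `Ω̄`: the edges of `E`. [folklore] -/
theorem extGraph_adj_inl_inl {x y : Site 2} :
    (extGraph E).Adj (.inl x) (.inl y) ↔ x ≠ y ∧ s(x, y) ∈ E := by
  simp [extGraph, SimpleGraph.fromRel_adj, Sym2.eq_swap]

/-- Adjacency of a lattice vertex and a formal external vertex in `Ω̄`: the pendant edge of an
external dart at its base vertex ("the only edge of `Ω̄` incident to `x_ext`").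
[cite: ChelkakDuminilCopinHongler2016, §3.3] -/
theorem extGraph_adj_inl_inr {x : Site 2} {d : Site 2 × Fin 4} :
    (extGraph E).Adj (.inl x) (.inr d) ↔ IsExtDart E d ∧ d.1 = x := by
  simp [extGraph, SimpleGraph.fromRel_adj]

/-- No two formal external vertices are adjacent in `Ω̄`. [folklore] -/
theorem extGraph_not_adj_inr_inr {d d' : Site 2 × Fin 4} : ¬ (extGraph E).Adj (.inr d) (.inr d') := by
  simp [extGraph, SimpleGraph.fromRel_adj]

/-- The far endpoint of an edge of `E` is a vertex of the domain. [folklore] -/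
theorem mem_verts_of_mem {x y : Site 2} (h : s(x, y) ∈ E) : y ∈ verts E :=
  Finset.mem_biUnion.2 ⟨s(x, y), h, by simp [endpts]⟩

/-- `e_{k+1} + e_{k-1} = 0` for the four lattice directions in cyclic order. [folklore] -/
theorem dir_add_one_add_dir_sub_one (k : Fin 4) : dir (k + 1) + dir (k - 1) = 0 := by
  fin_cases k <;> simp [dir]

/-- `e_{k-2} = -e_k` for the four lattice directions in cyclic order. [folklore] -/
theorem dir_sub_two (k : Fin 4) : dir (k - 2) = -dir k := by
  fin_cases k <;> simp [dir]

/-- **Boundary tracing stays on the boundary**: the successor of an external dart is an external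
dart (in the first three cases of `succ` the new dart points at a missing edge by the case
hypothesis; in the fourth the walk has gone round the unit square on the missing edge `x, x + e_k`
and returns the reversed dart `(x + e_k, k + 2)`, external by the hypothesis on `(x, k)`).
[folklore] -/
theorem IsExtDart.succ {d : Site 2 × Fin 4} (h : IsExtDart E d) : IsExtDart E (succ E d) := by
  obtain ⟨x, k⟩ := d
  obtain ⟨hx, hk⟩ := h
  dsimp only at hx hk
  unfold DiscreteRect.succ
  dsimp only
  split_ifs with h1 h2 h3
  · -- the three other sides of the unit square on `x, x + e_k` are edges: reversed dart
    refine ⟨mem_verts_of_mem h3, ?_⟩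
    dsimp only
    have e1 : x + dir (k + 1) + dir k + dir (k - 1) = x + dir k := by
      calc x + dir (k + 1) + dir k + dir (k - 1) = x + dir k + (dir (k + 1) + dir (k - 1)) := by abel
        _ = x + dir k := by rw [dir_add_one_add_dir_sub_one, add_zero]
    have e2 : x + dir k + dir (k - 2) = x := by
      rw [dir_sub_two, add_neg_cancel_right]
    rw [e1, e2, Sym2.eq_swap]
    exact hk
  · exact ⟨mem_verts_of_mem h2, h3⟩
  · exact ⟨mem_verts_of_mem h1, h2⟩
  · exact ⟨hx, h1⟩

/-- Every dart of the boundary-tracing orbit of an external dart is external. [folklore] -/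
theorem IsExtDart.iterate {d : Site 2 × Fin 4} (h : IsExtDart E d) (i : ℕ) :
    IsExtDart E ((DiscreteRect.succ E)^[i] d) := by
  induction i with
  | zero => exact h
  | succ i ih => rw [Function.iterate_succ_apply']; exact ih.succ

/-- In `Ω̄` the lattice edges are exactly the edges of `⟨E⟩ = fromEdgeSet E`. [folklore] -/
theorem extGraph_adj_inl_inl_iff_fromEdgeSet {x y : Site 2} :
    (extGraph E).Adj (.inl x) (.inl y) ↔
      (SimpleGraph.fromEdgeSet (↑E : Set (Sym2 (Site 2)))).Adj x y := by
  rw [extGraph_adj_inl_inl, SimpleGraph.fromEdgeSet_adj, Finset.mem_coe, and_comm]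

/-- **`ℓ_Ω[(ab),(cd)] ≤ ℓ_Ω̄[(a_ext b_ext),(c_ext d_ext)]`** for every presented rectangle
`IsRect E d₀ n` (in fact for every presentation: only the shape of the arcs is used): admissible
potentials of `Ω` extend along the pendant edges with the same energy, so `𝒞̄ ≤ 𝒞`.
[cite: ChelkakDuminilCopinHongler2016, §3.3 (first displayed property, lower bound)] -/
theorem innerResistance_le_extResistance (E : Finset (Sym2 (Site 2))) (d₀ : Site 2 × Fin 4)
    (n : Fin 4 → ℕ) :
    effectiveResistance (SimpleGraph.fromEdgeSet (↑E : Set (Sym2 (Site 2)))) 1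
        (arcVerts E d₀ n 0) (arcVerts E d₀ n 2) ≤ extResistance E d₀ n 0 2 := by
  refine ENNReal.inv_le_inv.2 (le_effectiveConductance fun v hvA hvZ ↦ ?_)
  refine (effectiveConductance_le_networkEnergy (v := Sum.elim v (v ∘ Prod.fst)) ?_ ?_).trans
    (networkEnergy_sumElim_le _ (extGraph E) Prod.fst
      (fun x y h ↦ extGraph_adj_inl_inl_iff_fromEdgeSet.1 h)
      (fun x d h ↦ (extGraph_adj_inl_inr.1 h).2) (fun d d' ↦ extGraph_not_adj_inr_inr) v)
  · rintro _ ⟨i, hi1, hi2, rfl⟩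
    exact hvA ⟨i, hi1, hi2, rfl⟩
  · rintro _ ⟨i, hi1, hi2, rfl⟩
    exact hvZ ⟨i, hi1, hi2, rfl⟩

/-- **`ℓ_Ω̄[(a_ext b_ext),(c_ext d_ext)] ≤ ℓ_Ω[(ab),(cd)] + 2`** for every discrete topological
rectangle `IsRect E d₀ n` (only `n 0, n 2 ≥ 1` and "the darts of the boundary cycle are external" are
used) — the upper half of CDH16's sandwich with the constant `2` in place of the printed
`4(2√2 - 1)`; the constant `2` is attained when the arcs `(ab)`, `(cd)` consist of one dart each
(series law). Proof: minimum/maximum of an admissible potential on the inner arcs, one pendant edge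
at each, clamping, Cauchy–Schwarz (see the module docstring). [folklore] -/
theorem extResistance_le_innerResistance_add_two {E : Finset (Sym2 (Site 2))} {d₀ : Site 2 × Fin 4}
    {n : Fin 4 → ℕ} (hR : IsRect E d₀ n) :
    extResistance E d₀ n 0 2 ≤
      effectiveResistance (SimpleGraph.fromEdgeSet (↑E : Set (Sym2 (Site 2)))) 1
        (arcVerts E d₀ n 0) (arcVerts E d₀ n 2) + 2 := by
  set G : SimpleGraph (Site 2) := SimpleGraph.fromEdgeSet (↑E : Set (Sym2 (Site 2))) with hG
  -- `(𝒞⁻¹ + 2)⁻¹ ≤ 𝒞̄`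
  have h2 : ((effectiveConductance G 1 (arcVerts E d₀ n 0) (arcVerts E d₀ n 2))⁻¹ + 2)⁻¹ ≤
      effectiveConductance (extGraph E) 1 (extArc E d₀ n 0) (extArc E d₀ n 2) := by
    refine le_effectiveConductance fun u huA huZ ↦ ?_
    -- the minimum `α` of `u` on `(ab)` and its maximum `β` on `(cd)`, through dart positions
    obtain ⟨ia, hia, hmin⟩ := (Finset.Ico (lo n 0) (lo n 0 + n 0)).exists_min_image
      (fun i ↦ u (.inl ((DiscreteRect.succ E)^[i] d₀).1))
      (Finset.nonempty_Ico.2 (by have := hR.pos 0; omega))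
    obtain ⟨iz, hiz, hmax⟩ := (Finset.Ico (lo n 2) (lo n 2 + n 2)).exists_max_image
      (fun i ↦ u (.inl ((DiscreteRect.succ E)^[i] d₀).1))
      (Finset.nonempty_Ico.2 (by have := hR.pos 2; omega))
    rw [Finset.mem_Ico] at hia hiz
    have hda1 : u (.inr ((DiscreteRect.succ E)^[ia] d₀)) = 1 := huA ⟨ia, hia.1, hia.2, rfl⟩
    have hdz0 : u (.inr ((DiscreteRect.succ E)^[iz] d₀)) = 0 := huZ ⟨iz, hiz.1, hiz.2, rfl⟩
    have hne : (DiscreteRect.succ E)^[ia] d₀ ≠ (DiscreteRect.succ E)^[iz] d₀ := fun h ↦ by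
      rw [h, hdz0] at hda1
      exact zero_ne_one hda1
    -- the two pendant edges (external darts, by `IsExtDart.iterate`)
    have hadjA : (extGraph E).Adj (.inl ((DiscreteRect.succ E)^[ia] d₀).1)
        (.inr ((DiscreteRect.succ E)^[ia] d₀)) :=
      extGraph_adj_inl_inr.2 ⟨hR.isExtDart.iterate ia, rfl⟩
    have hadjZ : (extGraph E).Adj (.inl ((DiscreteRect.succ E)^[iz] d₀).1)
        (.inr ((DiscreteRect.succ E)^[iz] d₀)) :=
      extGraph_adj_inl_inr.2 ⟨hR.isExtDart.iterate iz, rfl⟩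
    have hB := add_networkEnergy_comp_inl_le G (extGraph E)
      (fun x y h ↦ extGraph_adj_inl_inl_iff_fromEdgeSet.2 h) u hadjA hadjZ hne
    rw [hda1, hdz0, sub_zero, sub_sq_comm] at hB
    have hαA : ∀ x ∈ arcVerts E d₀ n 0,
        u (.inl ((DiscreteRect.succ E)^[ia] d₀).1) ≤ (u ∘ Sum.inl) x := by
      rintro x ⟨i, hi1, hi2, rfl⟩
      exact hmin i (Finset.mem_Ico.2 ⟨hi1, hi2⟩)
    have hβZ : ∀ x ∈ arcVerts E d₀ n 2,
        (u ∘ Sum.inl) x ≤ u (.inl ((DiscreteRect.succ E)^[iz] d₀).1) := by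
      rintro x ⟨i, hi1, hi2, rfl⟩
      exact hmax i (Finset.mem_Ico.2 ⟨hi1, hi2⟩)
    exact (inv_inv_add_two_le _ (networkEnergy G 1 (u ∘ Sum.inl)) _ _
      fun hlt ↦ effectiveConductance_mul_le_networkEnergy G 1 (u ∘ Sum.inl) hlt hαA hβZ).trans hB
  have h2' := ENNReal.inv_le_inv.2 h2
  rwa [inv_inv] at h2'

end Lattice

end DiscreteRect

open DiscreteRect in
/-- **Discharge of `discreteEL_ext_sandwich`** (Chelkak–Duminil-Copin–Hongler 2016, §3.3, first
displayed property `ℓ_Ω[(ab),(cd)] ≤ ℓ_Ω̄[(a_ext b_ext),(c_ext d_ext)] ≤ ℓ_Ω[(ab),(cd)] + 4(2√2-1)`,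
printed there without proof): the lower bound is `DiscreteRect.innerResistance_le_extResistance`, the
upper bound follows from the sharper `DiscreteRect.extResistance_le_innerResistance_add_two` since
`2 ≤ 4(2√2 - 1)`. [cite: ChelkakDuminilCopinHongler2016, §3.3 (first displayed property)] -/
theorem discreteEL_ext_sandwich_holds : discreteEL_ext_sandwich := by
  intro E d₀ n hR ℓ
  refine ⟨innerResistance_le_extResistance E d₀ n, ?_⟩
  have h22 : (2 : ℝ≥0∞) ≤ ENNReal.ofReal (4 * (2 * Real.sqrt 2 - 1)) := by
    rw [← ENNReal.ofReal_ofNat 2]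
    exact ENNReal.ofReal_le_ofReal
      (by nlinarith [Real.sq_sqrt (show (0 : ℝ) ≤ 2 by norm_num), Real.sqrt_nonneg 2])
  exact (extResistance_le_innerResistance_add_two hR).trans (add_le_add le_rfl h22)

end Literature.Probability.LatticeModels

end
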